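import Summits.Ventures.CertifiedArithmetic.LowPrec.DoubleRoundingProductRegisterSound

/-!
# Double rounding of products — the closed form ENLARGED by the exact clause (E)

HONEST FRAMING: certified error envelopes and provably optimal rounding/accumulation schemes for
low-precision formats under stated cost models; every table by two implementations; no hardware
or vendor claims.

`mulRegisterTest` (`DoubleRoundingProductRegisterDecision.lean`) is the verdict of `DRMul φ ψ` for
deep sources with headroom (DECISION D-mul-R) and is SOUND for every source
(`drMul_of_mulRegisterTest`, `DoubleRoundingProductRegisterSound.lean`).  For SHALLOW sources it is
not complete: the classical exact clause (E) — a register with at least twice the digits,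
`q ≥ 2P`, holds every product EXACTLY as soon as `qexp ψ ≤ 2·qexp φ`, i.e. `d ≥ bias + m − 1`
(`drMul_of_exact_of_embedsTest`, [Figueroa1995, §3]) — fires below the underflow threshold
`d ≥ 2m + 2` of clause (U) exactly when `bias ≤ m + 2`.  This file adds it:

* §1 `mulRegisterTestE := mulRegisterTest ∨ (2m + 1 ≤ m_ψ ∧ qexp ψ ≤ 2·qexp φ)`; THEOREM D-mul-R⁺ᴱ
  `drMul_of_mulRegisterTestE` (sound for every source with `m ≥ 1` and a normal binade, the same
  hypotheses as `drMul_of_mulRegisterTest`); for a DEEP source (`bias ≥ m + 3`) the new disjunct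
  implies clause (U), so the enlarged test has the same value (`mulRegisterTestE_eq_of_deep`) and
  DECISION D-mul-R holds verbatim with it (`drMul_register_iff_testE`).
* §2 The named matrix: the enlarged test is sound on all `67` embedded named pairs and IS the
  verdict on `63` of them (`mulRegisterTestE_named_sound`, `mulRegisterTestE_named_agree_count`) —
  it gains e2m1 → e2m3 (`q = 4 = 2P`, `d = 2 ≥ bias + m − 1 = 1`); the four cells it still misses
  are e2m1 → e3m2 / e5m2 / binary8p3 / binary8p3f (`q = 3 < 2P`: innocuous only because the one
  inexact odd product of e2m1 significands, `3·3 = 9`, is a midpoint of the precision-3 grid that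
  rounds to even AWAY from the e2m1 midpoint — exhaustion, `E2M1_mul_via_precision3`, no
  record-generic law) (`mulRegisterE_named_differ`).

Implementation A: `code/enum/mul_register_exact.py` → certificate C48
`certs/enum/DOUBLE-ROUNDING-MUL-REGISTER-EXACT.json` (the named census, and brute force OFF the
hypothesis of D-mul-R: the enlarged test ⟹ DRMul on every row, with the count of innocuous rows
it still misses); `DOUBLE-ROUNDING-MUL.md` §18.  PLACEMENT: clause (E) is classical
([Figueroa1995, §3]; with gradual underflow [Roux2014, Table II]); new here is only its place in
the register test. No hardware or vendor claims.
-/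

namespace Summit.Ventures.CertifiedArithmetic

open Literature.ComputerArithmetic.FloatingPoint
open Literature.ComputerArithmetic.FloatingPoint.Format
open Literature.ComputerArithmetic.FloatingPoint.MiniFloat

/-! ## §1 The enlarged test, its soundness, and its agreement with `mulRegisterTest` when deep -/

/-- THE ENLARGED CLOSED FORM: `mulRegisterTest`, or clause (E) — at least twice the digits and
`qexp ψ ≤ 2·qexp φ` (every product of `φ`-data is exact in `ψ` or beyond both tops).
[this packet] -/
def mulRegisterTestE (φ ψ : Format) : Bool :=
  mulRegisterTest φ ψ ||
    (decide (2 * φ.manBits + 1 ≤ ψ.manBits) && decide (ψ.qexp ≤ 2 * φ.qexp))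

/-- THEOREM D-mul-R⁺ᴱ (soundness of the enlarged test for every source): `F_φ ⊆ F_ψ`, `m ≥ 1`,
`2^m ≤ M_φ` and `mulRegisterTestE φ ψ` give `DRMul φ ψ` (`drMul_of_mulRegisterTest`, or clause
(E) `drMul_of_exact_of_embedsTest`). [this packet] -/
theorem drMul_of_mulRegisterTestE {φ ψ : Format} (hE : embedsTest φ ψ = true)
    (h1 : 1 ≤ φ.manBits) (hN : 2 ^ φ.manBits ≤ φ.maxScaled)
    (ht : mulRegisterTestE φ ψ = true) : DRMul φ ψ := by
  simp only [mulRegisterTestE, Bool.or_eq_true, Bool.and_eq_true, decide_eq_true_eq] at ht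
  rcases ht with ht | ⟨hm, hq⟩
  · exact drMul_of_mulRegisterTest hE h1 hN ht
  · exact drMul_of_exact_of_embedsTest hE hm hq

/-- FOR A DEEP SOURCE THE ENLARGED TEST IS THE OLD ONE: `bias ≥ m + 3` makes
`qexp ψ ≤ 2·qexp φ` (`d ≥ bias + m − 1`) imply `d ≥ 2m + 2`, clause (U) of `mulLawTest`.
[this packet] -/
theorem mulRegisterTestE_eq_of_deep {φ ψ : Format} (hdeep : φ.manBits + 3 ≤ φ.bias) :
    mulRegisterTestE φ ψ = mulRegisterTest φ ψ := by
  rw [Bool.eq_iff_iff]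
  simp only [mulRegisterTestE, Bool.or_eq_true, Bool.and_eq_true, decide_eq_true_eq]
  constructor
  · rintro (ht | ⟨hm, hq⟩)
    · exact ht
    · have hφ : φ.qexp = 1 - (φ.bias : ℤ) - φ.manBits := rfl
      have hU : ψ.qexp + (2 * φ.manBits + 2) ≤ φ.qexp := by omega
      simp [mulRegisterTest, mulLawTest, hm, hU, show ψ.qexp + 1 ≤ φ.qexp by omega]
  · exact fun ht => Or.inl ht

/-- DECISION D-mul-R WITH THE ENLARGED TEST (same hypotheses as `drMul_register_iff`).
[this packet] -/
theorem drMul_register_iff_testE {φ ψ : Format} (hE : embedsTest φ ψ = true)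
    (h1 : 1 ≤ φ.manBits) (hdeep : φ.manBits + 3 ≤ φ.bias)
    (hR : 2 ^ (φ.manBits + φ.bias + 1) ≤ φ.maxScaled) (hb' : 1 ≤ ψ.bias) :
    DRMul φ ψ ↔ mulRegisterTestE φ ψ = true := by
  rw [mulRegisterTestE_eq_of_deep hdeep]
  exact drMul_register_iff hE h1 hdeep hR hb'

/-! ## §2 The named matrix under the enlarged test -/

/-- SOUND ON ALL `67` EMBEDDED NAMED PAIRS (one kernel evaluation; also from
`drMul_of_mulRegisterTestE` and `drMul_named_iff`). [this packet] -/
theorem mulRegisterTestE_named_sound : ∀ X ∈ namedFormats, ∀ Y ∈ namedFormats,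
    embedsTest X Y = true → mulRegisterTestE X Y = true → (X, Y) ∈ drMulPairs := by
  decide +kernel

/-- … THE VERDICT ON `63` OF THEM (`62` for `mulRegisterTest`: e2m1 → e2m3 is gained by clause
(E)). [this packet] -/
theorem mulRegisterTestE_named_agree_count :
    (namedPairs.filter fun p => embedsTest p.1 p.2 &&
        (mulRegisterTestE p.1 p.2 == decide (p ∈ drMulPairs))).length = 63 ∧
    (mulRegisterTest E2M1 E2M3 = false ∧ mulRegisterTestE E2M1 E2M3 = true) := by
  refine ⟨by decide +kernel, by decide +kernel, by decide +kernel⟩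

/-- THE FOUR CELLS NO CLAUSE REACHES: e2m1 into the precision-3 registers (innocuous by
exhaustion, `E2M1_mul_via_precision3`). [this packet] -/
theorem mulRegisterE_named_differ :
    (namedPairs.filter fun p => embedsTest p.1 p.2 &&
        (mulRegisterTestE p.1 p.2 != decide (p ∈ drMulPairs))) =
      [(E2M1, E3M2), (E2M1, E5M2), (E2M1, Binary8p3), (E2M1, Binary8p3F)] := by
  decide +kernel

/-- THE NAMED SOUNDNESS THROUGH §1 (structural route). [this packet] -/
theorem drMul_named_of_mulRegisterTestE {X Y : Format} (hX : X ∈ namedFormats)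
    (hE : embedsTest X Y = true) (ht : mulRegisterTestE X Y = true) : DRMul X Y :=
  drMul_of_mulRegisterTestE hE (named_manBits_pos_normal X hX).1
    (named_manBits_pos_normal X hX).2 ht

end Summit.Ventures.CertifiedArithmetic
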